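import Summits.FinalStateConjecture.FinalStateConjecture.Theses.KerrnessPropagates

/-!
# `KerrBasinCapture` is false modulo a BAD-INTERIOR GERM (negative-side lemma for crux
`stmt-FinalStateConjecture-17646`, lead c2 of line `registered`, 2026-08-17)

The crux `KerrnessPropagates.KerrBasinCapture` quantifies over EVERY connected, Hausdorff, second-countable
one-ended data manifold `X` and asks, tame-Christodoulou-generically in `admissibleVacuumData X`, for the
INTERIOR LEMMA: every honest `C²` Kerr final-state decomposition `(O, d)` of every MGHD (sub-extremal holes,
`O = exteriorOf`, `HasExhaustiveCharts`, `IsFutureOriented`) keeps every future-complete normalised null ray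
from `Σ` inside `closure O` (`RaysStayInClosure`). This file records, kernel-checked, exactly which
construction falsifies the crux through that clause alone:

* `KerrBasinCapture_false_of_badInteriorGerm` — if some `X` carries an admissible datum `D` such that along
  EVERY tame one-parameter family of admissible data through `D` (on any end) all members with small
  parameter have an MGHD admitting an honest decomposition `(O, d)` as above with `¬ RaysStayInClosure O`
  (a "bad-interior germ": the exterior settles honestly while a future-complete null ray from `Σ` stays
  outside `closure O`), then `KerrBasinCapture` fails (at `k = 0`, on that `X`).

The hypothesis is the typed form of the bag-of-gold scenario named in the route's own "why it might fail"
(an asymptotically flat end glued through a throat to an eternally expanding vacuum region: on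
`X = Y ∖ {pt}`, `Y` a closed hyperbolic 3-manifold, Milne-quotient data glued to a Schwarzschild end by
localized connected-sum gluing (Chruściel–Isenberg–Pollack 2005); the expanding baby universe is expected
to carry future-complete rays behind the horizon, stably — a conjecture-level expectation resting on an
unproved `Λ = 0` future-stability statement, and not constructible in the tree (no MGHD is). The lemma is
pure logic over the definitions: the constant family through `D` is tame (`isTameDataFamily_const`), so `D`
itself is exceptional; the crux's escaping curve through `D` is tame with admissible members, so the germ
produces a small non-zero parameter whose member is again exceptional — contradicting the escape.
Nothing here asserts the hypothesis; the item stays open.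
-/

noncomputable section

set_option linter.dupNamespace false

namespace Summit.FinalStateConjecture.FinalStateConjecture.Theorems.KerrBasinCapture.Negative

open scoped Manifold ContDiff Topology
open Set Function Filter TopologicalSpace
open Literature.Geometry.Lorentzian

/-- **`KerrBasinCapture` is false modulo a bad-interior germ.** Hypothesis (the construction `H`, not
asserted): a data manifold `X` and an admissible datum `D` on it such that for every end `e` and every
tame one-parameter family `F` of admissible data on `e` with `F 0 = D` there is `δ > 0` such that every
member `F c`, `‖c‖ < δ`, has a maximal vacuum Cauchy development admitting an honest `C²` Kerr final-state
decomposition `(O, d)` — sub-extremal holes, `O = exteriorOf 𝒟 d.charted`, `HasExhaustiveCharts d`,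
`IsFutureOriented d` — with `¬ RaysStayInClosure 𝒟 O`. Conclusion: `¬ KerrBasinCapture`. Proof: at
`k = 0` the crux makes `Q₀` = (complete `𝓘⁺` ∧ recurrence ∧ interior lemma, for every MGHD)
tame-generic; the constant family through `D` is tame (sole Dafermos–Rodnianski-flat end of an admissible
datum, `InitialDataSet.isTameDataFamily_const`), so the germ at `c = 0` makes `D` exceptional; the
escaping tame curve `F` through `D` has admissible members, so the germ gives `δ`, and the member at the
parameter of norm `δ/2` is exceptional again (its bad decomposition violates the interior lemma) although
the curve escapes at every `c ≠ 0` — contradiction. -/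
theorem KerrBasinCapture_false_of_badInteriorGerm {X : Type} [TopologicalSpace X] [ChartedSpace E3 X]
    [IsManifold (𝓡 3) (⊤ : ℕ∞) X] [T2Space X] [SecondCountableTopology X] [ConnectedSpace X]
    (hH : ∃ D ∈ admissibleVacuumData X,
      ∀ (e : AFEnd X) (F : EuclideanSpace ℝ (Fin 1) → InitialDataSet (𝓡 3) X),
        InitialDataSet.IsTameDataFamily e 1 F → F 0 = D → (∀ c, F c ∈ admissibleVacuumData X) →
          ∃ δ : ℝ, 0 < δ ∧ ∀ c : EuclideanSpace ℝ (Fin 1), ‖c‖ < δ →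
            ∃ 𝒟 : VacuumCauchyDevelopment (F c), 𝒟.IsMaximal ∧
              ∃ (O : Set 𝒟.carrier) (d : FinalStateDecomposition 𝒟.toSpacetime O 2),
                (∀ i, Kerr.IsSubextremal (d.mass i) (d.spin i)) ∧
                  O = Summit.FinalStateConjecture.exteriorOf 𝒟.toCauchyDevelopment d.charted ∧
                    Summit.FinalStateConjecture.HasExhaustiveCharts d ∧
                      Summit.FinalStateConjecture.IsFutureOriented d ∧
                        ¬ Summit.FinalStateConjecture.RaysStayInClosure 𝒟.toCauchyDevelopment O) :
    ¬ Summit.FinalStateConjecture.FinalStateConjecture.Theses.KerrnessPropagates.KerrBasinCapture := by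
  intro hcrux
  obtain ⟨D, hD, hgerm⟩ := hH
  have hgen := hcrux 0 X
  -- a bad member is exceptional for `Q₀` (its bad decomposition violates the interior lemma)
  have hexc : ∀ (D' : InitialDataSet (𝓡 3) X),
      (∃ 𝒟 : VacuumCauchyDevelopment D', 𝒟.IsMaximal ∧
        ∃ (O : Set 𝒟.carrier) (d : FinalStateDecomposition 𝒟.toSpacetime O 2),
          (∀ i, Kerr.IsSubextremal (d.mass i) (d.spin i)) ∧
            O = Summit.FinalStateConjecture.exteriorOf 𝒟.toCauchyDevelopment d.charted ∧
              Summit.FinalStateConjecture.HasExhaustiveCharts d ∧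
                Summit.FinalStateConjecture.IsFutureOriented d ∧
                  ¬ Summit.FinalStateConjecture.RaysStayInClosure 𝒟.toCauchyDevelopment O) →
      ¬ (∀ 𝒟 : VacuumCauchyDevelopment D', 𝒟.IsMaximal →
          Summit.FinalStateConjecture.HasCompleteNullInfinity 𝒟.toCauchyDevelopment ∧
          (∃ (N : ℕ) (M a r₀ : Fin N → ℝ) (mo : Fin N → ↥lorentzGroup × E4), (∀ i, Kerr.IsSubextremal (M i) (a i) ∧ r₀ i ∈ Ioo (Kerr.rMinus (M i) (a i)) (Kerr.rPlus (M i) (a i))) ∧ ∀ ε : ℝ, 0 < ε → ∀ τ₁ : ℝ, ∃ τ : ℝ, τ₁ ≤ τ ∧ ∃ (R : Fin N → ℝ) (U : Opens E4) (Φ : U → 𝒟.carrier), (∀ i, r₀ i + 1 ≤ R i) ∧ ContMDiff 𝓘(ℝ, E4) (𝓡 4) (⊤ : ℕ∞) Φ ∧ Topology.IsOpenEmbedding Φ ∧ {x : E4 | x 0 = τ ∧ (∀ j, r₀ j < Kerr.radius (a j) (poincareInv (mo j).1 (mo j).2 x))} ⊆ (U : Set E4) ∧ range Φ ⊆ 𝒟.metric.causalFuture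 𝒟.timeOrientation (range 𝒟.embed) ∧ 𝒟.metric.IsAchronal 𝒟.timeOrientation (Φ '' {x : ↥U | (x : E4) 0 = τ}) ∧ (∀ i, supCkENorm {x : E4 | x 0 = τ ∧ (∀ j, r₀ j < Kerr.radius (a j) (poincareInv (mo j).1 (mo j).2 x)) ∧ Kerr.radius (a i) (poincareInv (mo i).1 (mo i).2 x) ≤ R i} 0 (𝒟.toSpacetime.deviationExtend ⟨U, boostedKerrBilin (mo i).1 (mo i).2 (M i) (a i), fun x ↦ x 0, fun x ↦ Kerr.radius (a i) (poincareInv (mo i).1 (mo i).2 x)⟩ Φ) ≤ ENNReal.ofReal ε) ∧ supCkENorm {x : E4 | x 0 = τ ∧ (∀ j, r₀ j < Kerr.radius (a j) (poincareInv (mo j).1 (mo j).2 x)) ∧ ∀ j, R j - 1 ≤ Kerr.radius (a j) (poincareInv (mo j).1 (mo j).2 x)} 0 (𝒟.toSpacetime.deviationExtend (Minkowski.backgroundOn U) Φ) ≤ ENNReal.ofReal ε ∧ (∀ x : ↥U, x.1 0 = τ → (∀ j, R j - 1 ≤ Kerr.radius (a j) (poincareInv (mo j).1 (mo j).2 x.1))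 → 𝒟.timeOrientation.IsFutureDirected (mfderiv 𝓘(ℝ, E4) (𝓡 4) Φ x (E4.basisVector 0)))) ∧
          (∀ (O : Set 𝒟.carrier) (d : FinalStateDecomposition 𝒟.toSpacetime O 2), (∀ i, Kerr.IsSubextremal (d.mass i) (d.spin i)) → O = Summit.FinalStateConjecture.exteriorOf 𝒟.toCauchyDevelopment d.charted → Summit.FinalStateConjecture.HasExhaustiveCharts d → Summit.FinalStateConjecture.IsFutureOriented d → Summit.FinalStateConjecture.RaysStayInClosure 𝒟.toCauchyDevelopment O)) := by
    rintro D' ⟨𝒟, hmax, O, d, hsub, hO, hex, hfo, hbad⟩ hQ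
    exact hbad ((hQ 𝒟 hmax).2.2 O d hsub hO hex hfo)
  -- `D` itself is exceptional: the constant family through `D` is tame
  obtain ⟨e₀, hsole, M₀, hSAF⟩ := exists_isSoleEnd_of_mem_admissibleVacuumData hD
  obtain ⟨δ₀, hδ₀, hbad₀⟩ := hgerm e₀ (fun _ ↦ D)
    (InitialDataSet.isTameDataFamily_const hsole 1 hSAF) rfl (fun _ ↦ hD)
  have hD_exc := hexc D (hbad₀ 0 (by simpa using hδ₀))
  -- the crux's escaping curve through `D`, and the germ along it
  obtain ⟨e, F, hF, -, h0, -, hadm, hgood⟩ := hgen D ⟨hD, hD_exc⟩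
  obtain ⟨δ, hδ, hbadF⟩ := hgerm e F hF h0 hadm
  obtain ⟨c, hc⟩ := exists_norm_eq (EuclideanSpace ℝ (Fin 1)) (half_pos hδ).le
  have hc_norm : ‖c‖ < δ := by rw [hc]; exact half_lt_self hδ
  have hc_ne : c ≠ 0 := by
    intro h
    rw [h, norm_zero] at hc
    exact (half_pos hδ).ne hc
  exact hgood c hc_ne ⟨hadm c, hexc (F c) (hbadF c hc_norm)⟩

end Summit.FinalStateConjecture.FinalStateConjecture.Theorems.KerrBasinCapture.Negative

end
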